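import Literature.NumberTheory.EllipticCurves.Kato2004.IwasawaH1CharacterFunctionalProofs
import Literature.NumberTheory.EllipticCurves.Kato2004.ZetaBodyLayerValuesProofs
import Literature.NumberTheory.GaloisRepresentations.BrauerTower
import Mathlib.Algebra.Algebra.Hom.Rat
import Mathlib.NumberTheory.Padics.Complex
import HarnessLib

/-!
# Kato 2004, Thm. 12.5 (1) in the finite-level currency: the `χ`-weighted dual-exponential sum at a cyclotomic
# LEVEL `ℚ(μ_m)` is a `ζ`-EIGENFUNCTIONAL on the LAYER `H¹(ℚ_n, T_pW)` (restriction to `Gal(ℚ̄/ℚ(μ_m)) ≤ Gal(ℚ̄/ℚ_n)`),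
# `ℤ_p`-semilinear, with value `#Gal(ℚ(μ_m)/ℚ_n) · Σ_b χ(b) ι_p(σ_b x)` on the corestriction of a class whose
# dual exponential is RATIONAL `1 ⊗ x` — THEOREMS ONLY (no definition, no named fact)

Topic `NumberTheory/EllipticCurves`, sub-directory `Kato2004` (namespace = path). Cell `bsd-2adic`, seat
`bsd-2adic-addL2x` (GEN 20; crux stmt-BirchSwinnertonDyer-19098 `AdditiveRankZeroAtTwo`, child C4″
stmt-BirchSwinnertonDyer-22618; road R-B83 (2)). This is the CONSTRUCTION behind the hypothesis `hw` of
`IwasawaH1Data.lengthAt_quotient_span_eq_of_layerFunctionals` (`IwasawaH1CharacterFunctionalProofs`, p741570): there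
the finite-level `χ(γ₀)`-eigenfunctionals `w` on `H¹(ℚ_n, T_pW)` were HYPOTHESES; here they are BUILT from a value
datum of the shape carried by `Kato2004.ZetaBody` (C3a)/(C4) — a `ℤ_p`-linear `Λ₀ : H¹(ℚ(μ_m), T_pW) → ℚ_p ⊗ ℚ(ζ_m)`
which is `Gal(ℚ(μ_m)/ℚ)`-equivariant («`exp* ∘ loc_p`», Kato §9.4 / Thm. 9.7) — a `p`-adic embedding
`ι_p : ℚ(ζ_m) → ℂ_p` and a `ℂ_p`-valued Dirichlet character `χ` mod `m`:

  `w(y) := Σ_{b ∈ (ℤ/m)ˣ} χ(b) · J((1 ⊗ σ_b)(Λ₀(res y)))`, `J(a ⊗ x) = a · ι_p(x)` (`res : H¹(ℚ_n) → H¹(ℚ(μ_m))`).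

Kato, Thm. 12.5 (1) [pp. 221–222]: «the map `S(f) ⊗ ℚ(ζ_{p^n}) → V(f) ⊗ ℚ̄_p; x ⊗ y ↦ Σ_{σ ∈ G_n} χ(σ)σ(y) per_f(x)^±`
… sends the image of `z_γ^{(p)}` to `L_{(p)}(f*, χ, r)·γ^±`» — this `χ`-weighted sum is our `w`; §13.8 [p. 228]: the
passage between the level `ℚ(ζ_{p^n})` and the `Δ`-trivial component / layer is the trace (here: `res ∘ cor = Σ conj`).

## What is proved (for ANY prime `p`, any level `k` with `Gal(ℚ̄/ℚ(μ_{m})) ≤ Gal(ℚ̄/ℚ_n)`, `m = m(k, ∅) = p^k`)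

* §1 `resLe_conjMap'` — restriction commutes with the `G`-action on `H¹` of normal subgroups (both composites are
  the map of the pair `(N → U, s ↦ g⁻¹sg; v ↦ g·v)`; the tree's `resLe_conjMap` is the discrete-coefficient case).
* §2 `exists_layerEigenfunctional` — the functional `w : H¹(ℚ_n, T_pW) →+ ℂ_p` above EXISTS with:
  (a) `ℤ_p`-semilinearity `w(c • y) = c · w(y)`; (b) the EIGEN-property `w(g · y) = χ(χ_cyc(g))⁻¹ · w(y)` for every
  `g ∈ Gal(ℚ̄/ℚ)` ((C3a): `Λ₀(g·y) = (1 ⊗ σ_{χ_cyc(g)})Λ₀(y)`, and `Σ_b χ(b)F(σ_bσ_u ·) = χ(u)⁻¹Σ_b χ(b)F(σ_b ·)`);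
  (c) the VALUE on a corestricted class: if `Λ₀(ξ) = 1 ⊗ x₁` ((C4): rationality, Thm. 9.7) and `χ` kills
  `χ_cyc(Gal(ℚ̄/ℚ_n))` (a character of `Gal(ℚ_n/ℚ)`), then
  `w(Cor_{ℚ(μ_m)/ℚ_n} ξ) = [ℚ(μ_m) : ℚ_n] · Σ_b χ(b) ι_p(σ_b x₁)` (`res ∘ cor = Σ_{δ} conj_δ`, NSW (1.5.7)).
Nothing is asserted beyond these displayed hypotheses; no `ZetaBody`/Kato fact is consumed here (the consumer feeds
(C3a)/(C4) of its witness, at `p = 2` with `k = n + 2`, `levelToLayerTwo`). HONEST FRAMING: linear algebra and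
Mackey's formula; BSD is not advanced.

References: K. Kato, Astérisque 295 (2004), Thm. 12.5 (1) pp. 221–222, §13.8 p. 228, Thm. 9.7 p. 189, Thm. 6.6 (1)
p. 163 [Kato2004Asterisque]; J. Neukirch, A. Schmidt, K. Wingberg, *Cohomology of Number Fields* (2008) I §5
(1.5.4), (1.5.6)–(1.5.7) [NeukirchSchmidtWingberg2008]; B. Mazur, J. Tate, J. Teitelbaum, Invent. Math. 84 (1986)
§I.13 (characters of `Γ` as `χ ↦ χ(γ₀)`) [MazurTateTeitelbaum1986Invent].
-/

set_option autoImplicit false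

noncomputable section

open scoped BigOperators NumberField TensorProduct
open CategoryTheory Field IsDedekindDomain
open _root_.TopRep _root_.ContRepresentation _root_.ContinuousCohomology
open Literature.NumberTheory.GaloisRepresentations
open Literature.NumberTheory.EllipticCurves Literature.NumberTheory.EllipticCurves.Kato2004.EulerSystemValues
  Rat.HeightOneSpectrum

namespace Literature.NumberTheory.EllipticCurves.Kato2004

/-! ## §1 `res ∘ (g ·) = (g ·) ∘ res` on `H¹` for normal subgroups `N ≤ U` -/

section ResConj

universe u v

variable {R : Type u} [CommRing R] [TopologicalSpace R] {G : Type v} [Group G] [TopologicalSpace G]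
  [IsTopologicalGroup G] (X : TopRep.{v} R G)

/-- **`res_{U→N} ∘ (g ·) = (g ·) ∘ res_{U→N}` in every degree** for normal subgroups `N ≤ U` of `G` and `g ∈ G`:
both composites are the map of the compatible pair `(N → U, s ↦ g⁻¹sg; v ↦ g·v)` (the tree's `resLe_conjMap` of
`LocalTwoMuConjTrivial` is the discrete-coefficient instance; same proof). [cite: NeukirchSchmidtWingberg2008, I §5 Prop. 1.5.4] -/
theorem resLe_conjMap' {N U : Subgroup G} [N.Normal] [U.Normal] (h : N ≤ U) (g : G) (q : ℕ)
    (y : continuousCohomology q (subgroupRep X U)) :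
    resLe X h q (conjMap X U g q y) = conjMap X N g q (resLe X h q y) := by
  let hg : TopRep.res (((Literature.NumberTheory.EllipticCurves.subgroupConj U g).comp (Literature.NumberTheory.EllipticCurves.subgroupInclusion h) : N →ₜ* U) : N →* U)
      (subgroupRep X U) ⟶ subgroupRep X N :=
    TopRep.ofHom ⟨X.ρ g, fun x => by
      ext m
      change X.ρ g (X.ρ (g⁻¹ * (x : G) * g) m) = X.ρ (x : G) (X.ρ g m)
      rw [mul_assoc, ρ_mul_apply, ρ_apply_ρ_inv_apply, ρ_mul_apply]⟩
  have h1 : ContinuousCohomology.map ((Literature.NumberTheory.EllipticCurves.subgroupConj U g).comp (Literature.NumberTheory.EllipticCurves.subgroupInclusion h)) hg q y =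
      resLe X h q (conjMap X U g q y) :=
    Literature.NumberTheory.GaloisRepresentations.map_comp_apply_of (X := subgroupRep X U) (Y := subgroupRep X U)
      (Z := subgroupRep X N) (Literature.NumberTheory.EllipticCurves.subgroupConj U g) (Literature.NumberTheory.EllipticCurves.subgroupInclusion h)
      ((Literature.NumberTheory.EllipticCurves.subgroupConj U g).comp (Literature.NumberTheory.EllipticCurves.subgroupInclusion h)) (fun _ => rfl)
      (conjRepHom X U g) (TopRep.ofHom ⟨ContinuousLinearMap.id R X, fun _ => rfl⟩) hg
      (fun _ => rfl) q y
  have h2 : ContinuousCohomology.map ((Literature.NumberTheory.EllipticCurves.subgroupConj U g).comp (Literature.NumberTheory.EllipticCurves.subgroupInclusion h)) hg q y =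
      conjMap X N g q (resLe X h q y) :=
    Literature.NumberTheory.GaloisRepresentations.map_comp_apply_of (X := subgroupRep X U) (Y := subgroupRep X N)
      (Z := subgroupRep X N) (Literature.NumberTheory.EllipticCurves.subgroupInclusion h) (Literature.NumberTheory.EllipticCurves.subgroupConj N g)
      ((Literature.NumberTheory.EllipticCurves.subgroupConj U g).comp (Literature.NumberTheory.EllipticCurves.subgroupInclusion h)) (fun _ => rfl)
      (TopRep.ofHom ⟨ContinuousLinearMap.id R X, fun _ => rfl⟩) (conjRepHom X N g) hg
      (fun _ => rfl) q y
  rw [← h1, h2]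

end ResConj

/-! ## §2 The `χ`-weighted dual-exponential sum as a finite-level eigenfunctional on the layer -/

section Functional

variable {W : WeierstrassCurve ℚ} [W.IsElliptic] {p : ℕ} [Fact p.Prime] [ContinuousSMul ℤ_[p] (W.tateModule p)]

/-- `σ_b ∘ σ_u = σ_{bu}` as `ℚ`-algebra maps of `ℚ(ζ_m)`. [cite: Kato2004Asterisque, (5.7.1) (p. 157)] -/
private theorem sigma_comp_sigma (m : ℕ) [NeZero m] (b u : (ZMod m)ˣ) :
    ((sigma m b : CyclotomicField m ℚ ≃ₐ[ℚ] CyclotomicField m ℚ) :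
        CyclotomicField m ℚ →ₐ[ℚ] CyclotomicField m ℚ).comp
      (sigma m u : CyclotomicField m ℚ →ₐ[ℚ] CyclotomicField m ℚ) =
      (sigma m (b * u) : CyclotomicField m ℚ →ₐ[ℚ] CyclotomicField m ℚ) := by
  ext x
  change sigma m b (sigma m u x) = sigma m (b * u) x
  rw [sigma_mul_apply]

/-- Character-weighted sums re-index: `Σ_b χ(b) F(b·u) = χ(u)⁻¹ · Σ_b χ(b) F(b)` for a `K`-valued Dirichlet character
(`b ↦ bu` is a bijection of `(ℤ/m)ˣ`; `χ(bu⁻¹) = χ(b)χ(u)⁻¹`). [cite: Kato2004Asterisque, Thm. 6.6 (1) (p. 163)] -/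
private theorem sum_char_mul_comp_mul {m : ℕ} [NeZero m] {K : Type*} [Field K] (χ : DirichletCharacter K m)
    (F : (ZMod m)ˣ → K) (u : (ZMod m)ˣ) :
    ∑ b : (ZMod m)ˣ, χ (b : ZMod m) * F (b * u) = (χ (u : ZMod m))⁻¹ * ∑ b : (ZMod m)ˣ, χ (b : ZMod m) * F b := by
  rw [Finset.mul_sum]
  refine Fintype.sum_equiv (Equiv.mulRight u) _ _ fun b ↦ ?_
  rw [Equiv.coe_mulRight]
  have hu : χ (u : ZMod m) ≠ 0 := by
    rw [← MulChar.coe_toUnitHom]; exact (χ.toUnitHom u).ne_zero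
  have : χ ((b * u : (ZMod m)ˣ) : ZMod m) = χ (b : ZMod m) * χ (u : ZMod m) := by
    rw [Units.val_mul, map_mul]
  rw [this]
  field_simp

/-- **The `χ`-weighted dual-exponential sum is a finite-level eigenfunctional on the layer** (Kato Thm. 12.5 (1) in
the currency of `IwasawaH1Data.lengthAt_quotient_span_eq_of_layerFunctionals`). Data: `U` a normal subgroup of
`Gal(ℚ̄/ℚ)` (the layer group `Gal(ℚ̄/ℚ_n)`), a level `k` with `N := Gal(ℚ̄/ℚ(μ_m)) ≤ U` of finite index (`m = m(k,∅)`), a `ℤ_p`-linear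
`Λ₀ : H¹(ℚ(μ_m), T_pW) → ℚ_p ⊗ ℚ(ζ_m)` that is `Gal(ℚ(μ_m)/ℚ)`-equivariant (shape (C3a) of `Kato2004.ZetaBody`), a
`p`-adic embedding `ι_p : ℚ(ζ_m) → ℂ_p` and a Dirichlet character `χ` mod `m` with values in `ℂ_p`. Then there is an
additive `w : H¹(U, T_pW) → ℂ_p` — namely `w(y) = Σ_b χ(b)·J((1 ⊗ σ_b)Λ₀(res y))`, `J(a ⊗ x) = a·ι_p(x)` — such
that: (a) `w(c • y) = c·w(y)` for `c ∈ ℤ_p`; (b) `w(g·y) = χ(χ_cyc(g))⁻¹·w(y)` for every `g ∈ Gal(ℚ̄/ℚ)` — an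
EIGENFUNCTIONAL for the `Gal(ℚ̄/ℚ)`-action; (c) for every `ξ ∈ H¹(ℚ(μ_m), T_pW)` with RATIONAL value
`Λ₀(ξ) = 1 ⊗ x₁` ((C4)), if `χ` kills `χ_cyc(U)` then `w(Cor_{N}^{U} ξ) = [U : N]·Σ_b χ(b)ι_p(σ_b x₁)`
(`res ∘ cor = Σ_δ conj_δ` and each `δ ∈ U` contributes `χ(χ_cyc δ)⁻¹ = 1`).
[cite: Kato2004Asterisque, Thm. 12.5 (1) (pp. 221–222), §13.8 (p. 228), Thm. 9.7 (p. 189)]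
[cite: NeukirchSchmidtWingberg2008, I §5 (1.5.6)–(1.5.7)] -/
theorem exists_layerEigenfunctional {U : Subgroup (absoluteGaloisGroup ℚ)} [U.Normal]
    (k : ℕ) (hle : cycSubgroup p k ∅ ≤ U)
    [Fintype (U ⧸ (cycSubgroup p k ∅).subgroupOf U)]
    (Λ₀ : H1 (tateRep W p) (cycSubgroup p k ∅) →ₗ[ℤ_[p]] ℚ_[p] ⊗[ℚ] CyclotomicField (cycLevel p k ∅) ℚ)
    (hΛ : ∀ (σ : absoluteGaloisGroup ℚ) (y : H1 (tateRep W p) (cycSubgroup p k ∅)),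
      Λ₀ (conjMap (tateRep W p).toTopRep (cycSubgroup p k ∅) σ 1 y) =
        Algebra.TensorProduct.map (AlgHom.id ℚ ℚ_[p])
          (sigma (cycLevel p k ∅) (modNCyclotomicCharacter ℚ (cycLevel p k ∅) σ) :
            CyclotomicField (cycLevel p k ∅) ℚ →ₐ[ℚ] CyclotomicField (cycLevel p k ∅) ℚ) (Λ₀ y))
    (ιp : CyclotomicField (cycLevel p k ∅) ℚ →+* ℂ_[p]) (χ : DirichletCharacter ℂ_[p] (cycLevel p k ∅)) :
    ∃ w : H1 (tateRep W p) U →+ ℂ_[p],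
      (∀ (c : ℤ_[p]) (y : H1 (tateRep W p) U),
        w (c • y) = ((algebraMap ℚ_[p] ℂ_[p]).comp (algebraMap ℤ_[p] ℚ_[p])) c * w y) ∧
      (∀ (g : absoluteGaloisGroup ℚ) (y : H1 (tateRep W p) U),
        w ((conjMap (tateRep W p).toTopRep U g 1).hom.toLinearMap y) =
          (χ ((modNCyclotomicCharacter ℚ (cycLevel p k ∅) g : (ZMod (cycLevel p k ∅))ˣ) :
            ZMod (cycLevel p k ∅)))⁻¹ * w y) ∧
      (∀ (ξ : H1 (tateRep W p) (cycSubgroup p k ∅)) (x₁ : CyclotomicField (cycLevel p k ∅) ℚ),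
        Λ₀ ξ = (1 : ℚ_[p]) ⊗ₜ[ℚ] x₁ →
        (∀ σ ∈ U, χ ((modNCyclotomicCharacter ℚ (cycLevel p k ∅) σ : (ZMod (cycLevel p k ∅))ˣ) :
          ZMod (cycLevel p k ∅)) = 1) →
        w (coresLe (tateRep W p).toTopRep hle ((cyclotomicLevelsRat p ∅).isOpen_level k ∅) ξ) =
          (Fintype.card (U ⧸ (cycSubgroup p k ∅).subgroupOf U) : ℂ_[p]) *
            ∑ b : (ZMod (cycLevel p k ∅))ˣ, χ (b : ZMod (cycLevel p k ∅)) *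
              ιp (sigma (cycLevel p k ∅) b x₁)) := by
  haveI : (cycSubgroup p k ∅).Normal := normal_cyclotomicLevelsRat_level_empty p ∅ k
  -- `J : ℚ_p ⊗ ℚ(ζ_m) → ℂ_p`, `a ⊗ x ↦ a · ι_p x`
  let J : ℚ_[p] ⊗[ℚ] CyclotomicField (cycLevel p k ∅) ℚ →ₐ[ℚ] ℂ_[p] :=
    Algebra.TensorProduct.lift (algebraMap ℚ_[p] ℂ_[p]).toRatAlgHom ιp.toRatAlgHom (fun _ _ ↦ Commute.all _ _)
  have hJ : ∀ (a : ℚ_[p]) (x : CyclotomicField (cycLevel p k ∅) ℚ),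
      J (a ⊗ₜ[ℚ] x) = algebraMap ℚ_[p] ℂ_[p] a * ιp x := fun a x ↦ by
    change Algebra.TensorProduct.lift _ _ _ (a ⊗ₜ[ℚ] x) = _
    rw [Algebra.TensorProduct.lift_tmul]; rfl
  -- `τ b := 1 ⊗ σ_b`
  let τ : (ZMod (cycLevel p k ∅))ˣ →
      (ℚ_[p] ⊗[ℚ] CyclotomicField (cycLevel p k ∅) ℚ →ₐ[ℚ] ℚ_[p] ⊗[ℚ] CyclotomicField (cycLevel p k ∅) ℚ) :=
    fun b ↦ Algebra.TensorProduct.map (AlgHom.id ℚ ℚ_[p])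
      (sigma (cycLevel p k ∅) b : CyclotomicField (cycLevel p k ∅) ℚ →ₐ[ℚ] CyclotomicField (cycLevel p k ∅) ℚ)
  have hτ : ∀ b : (ZMod (cycLevel p k ∅))ˣ, Algebra.TensorProduct.map (AlgHom.id ℚ ℚ_[p])
      (sigma (cycLevel p k ∅) b : CyclotomicField (cycLevel p k ∅) ℚ →ₐ[ℚ] CyclotomicField (cycLevel p k ∅) ℚ) =
      τ b := fun _ ↦ rfl
  have hτ_mul : ∀ (b u : (ZMod (cycLevel p k ∅))ˣ) (t : ℚ_[p] ⊗[ℚ] CyclotomicField (cycLevel p k ∅) ℚ),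
      τ b (τ u t) = τ (b * u) t := by
    intro b u t
    change ((τ b).comp (τ u)) t = τ (b * u) t
    congr 1
    change (Algebra.TensorProduct.map (AlgHom.id ℚ ℚ_[p]) _).comp
        (Algebra.TensorProduct.map (AlgHom.id ℚ ℚ_[p]) _) = Algebra.TensorProduct.map (AlgHom.id ℚ ℚ_[p]) _
    rw [← Algebra.TensorProduct.map_comp, AlgHom.comp_id, sigma_comp_sigma]
  have hτ_tmul : ∀ (b : (ZMod (cycLevel p k ∅))ˣ) (a : ℚ_[p]) (x : CyclotomicField (cycLevel p k ∅) ℚ),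
      τ b (a ⊗ₜ[ℚ] x) = a ⊗ₜ[ℚ] sigma (cycLevel p k ∅) b x := by
    intro b a x
    change Algebra.TensorProduct.map _ _ (a ⊗ₜ[ℚ] x) = _
    rw [Algebra.TensorProduct.map_tmul, AlgHom.id_apply]
    rfl
  -- the restriction `res : H¹(U) → H¹(N₀)`: linear, commutes with the Galois action
  have hres_smul : ∀ (c : ℤ_[p]) (y : H1 (tateRep W p) U),
      resLe (tateRep W p).toTopRep hle 1 (c • y) = c • resLe (tateRep W p).toTopRep hle 1 y :=
    fun c y ↦ map_smul (resLe (tateRep W p).toTopRep hle 1).hom c y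
  have hres_conj : ∀ (g : absoluteGaloisGroup ℚ) (y : H1 (tateRep W p) U),
      resLe (tateRep W p).toTopRep hle 1 ((conjMap (tateRep W p).toTopRep U g 1).hom.toLinearMap y) =
        conjMap (tateRep W p).toTopRep (cycSubgroup p k ∅) g 1 (resLe (tateRep W p).toTopRep hle 1 y) :=
    fun g y ↦ resLe_conjMap' (tateRep W p).toTopRep hle g 1 y
  -- the functional
  let wfun : H1 (tateRep W p) U → ℂ_[p] := fun y ↦
    ∑ b : (ZMod (cycLevel p k ∅))ˣ, χ (b : ZMod (cycLevel p k ∅)) *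
      J (τ b (Λ₀ (resLe (tateRep W p).toTopRep hle 1 y)))
  have hw_add : ∀ y₁ y₂, wfun (y₁ + y₂) = wfun y₁ + wfun y₂ := by
    intro y₁ y₂
    simp only [wfun, map_add, mul_add, Finset.sum_add_distrib]
  refine ⟨AddMonoidHom.mk' wfun hw_add, ?_, ?_, ?_⟩
  · -- (a) `ℤ_p`-semilinearity
    intro c y
    change wfun (c • y) = _ * wfun y
    simp only [wfun]
    rw [Finset.mul_sum]
    refine Finset.sum_congr rfl fun b _ ↦ ?_
    rw [hres_smul, map_smul]
    -- `c • t = (c ⊗ 1) * t` in `ℚ_p ⊗ ℚ(ζ_m)`, and `τ b`, `J` are algebra maps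
    have hsmul : ∀ t : ℚ_[p] ⊗[ℚ] CyclotomicField (cycLevel p k ∅) ℚ,
        c • t = ((algebraMap ℤ_[p] ℚ_[p] c) ⊗ₜ[ℚ] (1 : CyclotomicField (cycLevel p k ∅) ℚ)) * t := by
      intro t
      induction t using TensorProduct.induction_on with
      | zero => rw [smul_zero, mul_zero]
      | tmul a x =>
        rw [TensorProduct.smul_tmul', Algebra.TensorProduct.tmul_mul_tmul, one_mul, Algebra.smul_def]
      | add s t hs ht => rw [smul_add, hs, ht, mul_add]
    rw [hsmul, map_mul, map_mul, hτ_tmul, map_one, hJ, map_one, mul_one]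
    change _ = algebraMap ℚ_[p] ℂ_[p] (algebraMap ℤ_[p] ℚ_[p] c) * _
    ring
  · -- (b) eigen-property
    intro g y
    change wfun _ = _ * wfun y
    simp only [wfun]
    rw [hres_conj, hΛ g, hτ]
    simp_rw [hτ_mul]
    exact sum_char_mul_comp_mul χ (fun b ↦ J (τ b (Λ₀ (resLe (tateRep W p).toTopRep hle 1 y)))) _
  · -- (c) the value on a corestricted class with rational dual exponential
    intro ξ x₁ hξ hχU
    change wfun _ = _
    simp only [wfun]
    have hs : ∀ t : U ⧸ (cycSubgroup p k ∅).subgroupOf U,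
        ((Quotient.out t : U) : U ⧸ (cycSubgroup p k ∅).subgroupOf U) = t :=
      fun t ↦ QuotientGroup.out_eq' t
    rw [resLe_coresLe_eq_sum_conjMap (tateRep W p).toTopRep hle ((cyclotomicLevelsRat p ∅).isOpen_level k ∅)
      hs ξ, map_sum]
    simp_rw [hΛ, hξ, hτ, map_sum, hτ_mul, hτ_tmul, hJ, map_one, one_mul, Finset.mul_sum]
    rw [Finset.sum_comm]
    -- re-index each inner sum: `Σ_b χ(b) ι(σ_{b u_t} x₁) = χ(u_t)⁻¹ Σ_b χ(b) ι(σ_b x₁) = Σ_b χ(b) ι(σ_b x₁)`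
    have hinner : ∀ t : U ⧸ (cycSubgroup p k ∅).subgroupOf U,
        ∑ b : (ZMod (cycLevel p k ∅))ˣ, χ (b : ZMod (cycLevel p k ∅)) *
          ιp (sigma (cycLevel p k ∅)
            (b * modNCyclotomicCharacter ℚ (cycLevel p k ∅) ((Quotient.out t : U) : absoluteGaloisGroup ℚ)) x₁) =
        ∑ b : (ZMod (cycLevel p k ∅))ˣ, χ (b : ZMod (cycLevel p k ∅)) * ιp (sigma (cycLevel p k ∅) b x₁) := by
      intro t
      rw [sum_char_mul_comp_mul χ (fun b ↦ ιp (sigma (cycLevel p k ∅) b x₁)), hχU _ (Quotient.out t).2,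
        inv_one, one_mul]
    simp_rw [hinner]
    rw [Finset.sum_const, Finset.card_univ, nsmul_eq_mul, Finset.mul_sum]

end Functional

end Literature.NumberTheory.EllipticCurves.Kato2004

end
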